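import Summits.BirchSwinnertonDyer.BirchSwinnertonDyer.Theorems.GoldfeldAllTwistsTwoConverseTwinQuarterTraceIndexB4SharpLocusUnion
import Summits.BirchSwinnertonDyer.BirchSwinnertonDyer.Theorems.GoldfeldAllTwistsTwoConverseTwinQuarterTraceCongruenceUnion
import HarnessLib

set_option linter.dupNamespace false -- namespace `…BirchSwinnertonDyer.BirchSwinnertonDyer…` is the cell's (D-0017 nested layout)
set_option autoImplicit false

/-!
# `BSD(W, 2)` ON THE CONGRUENCE-ONLY SUB-FAMILY `q ≡ 7 (mod 8)`, `p ≡ 5 (mod 8)` of `W ≅ 49a1^{(−2qp)}` — NO type condition, NO `(p/q)`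
# condition (companion of `…TwinQuarterTraceCongruenceUnion`; the hypotheses are two residue classes mod `56`)

Cell `bsd-goldfeld`, seat `bsd-goldfeld-s1p-c3x` (gen 19). SCRATCH of record (pointer P1 of STATUS 2026-08-29 c3x-g19; NOT proposed without a
route-owner word). `--supports stmt-BirchSwinnertonDyer-19140` as a HELPER (formula axis) if ever filed. Theses-free; theorems only; no definition,
no new fact, no `sorry`, no kit. PARENT: the formula-axis sharp-locus capstone F (`…TwinQuarterTraceIndexB4SharpLocusUnion`, p725691), whose
`hcell` holds on the pair `q ≡ 7 (mod 8)`, `p ≡ 5 (mod 8)` for EITHER sign of `(p/q)` and EITHER type (cells C4, C8, a75+, b75+ — all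
first-descent-sharp). §1 = `BSDp W 2` for every globally minimal elliptic `W` with `C • W = X₀(49)^{(−2qp)}` on that pair; §2 = the same with the
hypotheses written as `q ≡ 31, 47, 55 (mod 56)`, `p ≡ 29, 37, 53 (mod 56)` (the arithmetic is `…CongruenceUnion` §0). EIGHTEEN named inputs = the
parent's, by name (variable block letter-identical); NO Cassels–Tate. HONEST FRAMING: density-zero sub-families modulo named print (SELMER-DRIFT
ceiling); FRONTIER-grade, never distance-to-summit; twin″ NOT closed; items 19350 / 19140 / 20044 unchanged; BSD is not proved by any of this.

References: [Miller2011LMS] Def. 1.1; [GrossZagier1986] Thm I.(6.3), V.§2; [CoatesLiTianZhai2015] Thm 1.2–1.4, 4.4; [LiMa2008] Thm 0.4;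
[BurungaleCastellaSkinnerTian2022] Thm A, Rem. D; [SilvermanAEC2009] Thm X.4.14.
-/

noncomputable section

open scoped Classical

open WeierstrassCurve NumberField Literature.NumberTheory Literature.NumberTheory.EllipticCurves
  Literature.NumberTheory.EllipticCurves.ModularForms Literature.NumberTheory.EllipticCurves.CaiShuTian2014
  Literature.NumberTheory.EllipticCurves.CoatesLiTianZhai2015

namespace Summit.BirchSwinnertonDyer.BirchSwinnertonDyer.Theorems.GoldfeldGoodTwists

section CapstoneFormulaCongruence

variable (hCST : thm11_ringClassChar)
  (hGZ : ∀ (N : ℕ) [NeZero N] (W : WeierstrassCurve ℚ) (K : Type) [Field K] [NumberField K], gross_zagier N W K)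
  (h12 : thm12_fullBSD_twist) (h44 : thm44_ord_two_LAlg) (h13 : thm13_ord_two_LAlg) (h14 : thm14_rankOne_twist)
  (hS31 : bsdTriple_of_rank_le_one_of_conductor_lt) (hnew : exists_isNewformOf) (hM : OptimalCurveManinCertificate cm7)
  (hBT : burungaleTian_analyticRank_eq_zero_of_selmerCorank_eq_zero_of_hasCM) (hBF : bsdTriple_of_hasCM_of_L_one_ne_zero)
  (hGZK : rank_eq_analyticRank_of_analyticRank_le_one) (hEta : x049_heegner_norm_x_sub_two_not_mem)
  (hEta₀ : x049_x_sub_two_eq_etaQuotient) (hD : deuring_etaQuotient49_heegner_generates_conjPrime)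
  (hBCST : BurungaleCastellaSkinnerTian2022.thmA_analyticRank_eq_one_of_selmerCorank_eq_one)
  (hpar : ∀ (V : WeierstrassCurve ℚ) [V.IsElliptic], p_parity V 2)
  (hKo : ∀ (N : ℕ) [NeZero N] (W : WeierstrassCurve ℚ) (K : Type) [Field K] [NumberField K], kolyvagin N W K)
include hCST hGZ h12 h44 h13 h14 hS31 hnew hM hBT hBF hGZK hEta hEta₀ hD hBCST hpar hKo

/-- **`BSD(W, 2)` ON THE CONGRUENCE-ONLY PAIR, FROM PRINT + KOLYVAGIN.** `q ≡ 7 (mod 8)` prime, `(q/7) = −1`; `p ≡ 5 (mod 8)` prime,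
`(−7/p) = +1` — NO type condition, NO condition on `(p/q)`; `W/ℚ` globally minimal elliptic with `C • W = X₀(49)^{(−2qp)}`: **`BSD(W, 2)`**
(Miller: rank part, `Ш(W)[2^∞]` finite, `ord₂ #Ш_an = ord₂ #Ш[2^∞]`) — `(p/q) = ±1` (`jacobiSym.eq_one_or_neg_one`) onto the parent's `hcell`, i.e.
onto cells C4 ∪ C8 ∣ a75+ ∪ b75+ of `bsdp_two_negTwoPrimesTwist_sharpLocus_of_print_sharp`. EIGHTEEN named inputs, nothing else; NO Cassels–Tate.
With the rank-axis companion `analyticRank_eq_one_twoPrimesTwist_sevenModEight_fiveModEight_symbolFree_of_print`: `BSD(W,2) ∧ r_an(W) = rank W(ℚ) = 1 ∧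
Ш(W)` finite on the whole pair. Density-zero sub-families modulo named print; FRONTIER-grade; twin″ NOT closed; BSD is not proved by any of this.
[cite: Miller2011LMS, Def. 1.1] [cite: GrossZagier1986, Thm. I.(6.3) and V.§2] [cite: CoatesLiTianZhai2015, Thm. 1.2 (p. 359), 1.3, 1.4 and 4.4]
[cite: LiMa2008, Thm. 0.4] [cite: BurungaleCastellaSkinnerTian2022, Thm. A (p. 326) and Rem. D (p. 327)] [cite: SilvermanAEC2009, Thm. X.4.14] -/
theorem bsdp_two_negTwoPrimesTwist_sevenModEight_fiveModEight_symbolFree_of_print_sharp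
    {q p : ℕ} (hq : q.Prime) (hq8 : q % 8 = 7) (hq7 : jacobiSym q 7 = -1)
    [Fact p.Prime] (hp8 : p % 8 = 5) (hp7 : legendreSym p (-7) = 1)
    (W : WeierstrassCurve ℚ) [W.IsElliptic] [W.IsGloballyMinimal] (C : VariableChange ℚ)
    (hC : C • W = cm7.quadraticTwist (-(2 * (q : ℚ) * p))) : BSDp W 2 := by
  have hp : p.Prime := Fact.out
  have hgcd : (p : ℤ).gcd q = 1 := by
    rw [Int.gcd_natCast_natCast]
    exact (Nat.coprime_primes hp hq).mpr (by rintro rfl; omega)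
  rcases jacobiSym.eq_one_or_neg_one hgcd with hpq | hpq
  · exact bsdp_two_negTwoPrimesTwist_sharpLocus_of_print_sharp hCST hGZ h12 h44 h13 h14 hS31 hnew hM hBT hBF hGZK hEta hEta₀ hD hBCST hpar hKo
      hq (by omega) (by omega) hq7 (by omega) hp7 (Or.inr ⟨hpq, Or.inr hp8⟩) W C hC
  · exact bsdp_two_negTwoPrimesTwist_sharpLocus_of_print_sharp hCST hGZ h12 h44 h13 h14 hS31 hnew hM hBT hBF hGZK hEta hEta₀ hD hBCST hpar hKo
      hq (by omega) (by omega) hq7 (by omega) hp7 (Or.inl ⟨hpq, Or.inl hq8⟩) W C hC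

/-- **`BSD(W, 2)`, CONGRUENCE FORM.** For all primes `q ≡ 31, 47, 55 (mod 56)` and `p ≡ 29, 37, 53 (mod 56)` and every globally minimal elliptic
`W/ℚ` with `C • W = X₀(49)^{(−2qp)}`: `BSDp W 2` (`…CongruenceUnion` §0 + §1 here). EIGHTEEN named inputs, nothing else; NO Cassels–Tate;
density-zero sub-families modulo named print; twin″ NOT closed; BSD is not proved by any of this. [cite: Miller2011LMS, Def. 1.1]
[cite: GrossZagier1986, Thm. I.(6.3) and V.§2] [cite: CoatesLiTianZhai2015, Thm. 1.2 (p. 359), 1.3, 1.4 and 4.4] [cite: LiMa2008, Thm. 0.4]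
[cite: BurungaleCastellaSkinnerTian2022, Thm. A (p. 326) and Rem. D (p. 327)] [cite: SilvermanAEC2009, Thm. X.4.14] -/
theorem bsdp_two_negTwoPrimesTwist_mod_fiftySix_of_print_sharp
    {q p : ℕ} (hq : q.Prime) (hq56 : q % 56 = 31 ∨ q % 56 = 47 ∨ q % 56 = 55)
    [Fact p.Prime] (hp56 : p % 56 = 29 ∨ p % 56 = 37 ∨ p % 56 = 53)
    (W : WeierstrassCurve ℚ) [W.IsElliptic] [W.IsGloballyMinimal] (C : VariableChange ℚ)
    (hC : C • W = cm7.quadraticTwist (-(2 * (q : ℚ) * p))) : BSDp W 2 := by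
  obtain ⟨hq8, hq7⟩ := (sevenModEight_and_jacobiSym_seven_eq_neg_one_iff_mod_fiftySix q).mpr hq56
  obtain ⟨hp8, hp7⟩ := fiveModEight_and_legendreSym_neg_seven_of_mod_fiftySix hp56
  exact bsdp_two_negTwoPrimesTwist_sevenModEight_fiveModEight_symbolFree_of_print_sharp hCST hGZ h12 h44 h13 h14 hS31 hnew hM hBT hBF hGZK hEta
    hEta₀ hD hBCST hpar hKo hq hq8 hq7 hp8 hp7 W C hC

end CapstoneFormulaCongruence

end Summit.BirchSwinnertonDyer.BirchSwinnertonDyer.Theorems.GoldfeldGoodTwists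

end
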